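import Summits.AtomisticToContinuum.HydrodynamicLimit.Theses.JParityClosure
import Literature.Analysis.FluidPDE.HardSphereRegularGeometry

/-!
# Negative knowledge for crux `JParityClosure.OddContactSymmetry` (stmt-AtomisticToContinuum-13078):
# the parity residual, the r-ball mixture obstruction, ϑ-tightness, J-kinematics

From the standing disprover's `Cruxes/OddContactSymmetry/Disproof.lean` (refuter-cdisprove-stmt-AtomisticToContinuum-13078-0,
2026-08-16), the sorry-free, dynamics-free part, made importable for ideators / planners / the lead:

* `odd_sum_vanishes_iff_even` — finite skeleton of ParitySplit: a weight is invisible to EVERY `J`-odd test function iff it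
  is `J`-even (what oddness of the mark buys, exactly).
* `reweighted_odd_residual`, `reweighted_odd_residual_eq_zero_iff` — the `J`-odd part of the crux's reweighted contact
  weight `a(1 + b′/b)` is `(ab′ − a′b)(1/b + 1/b′)`: the limit content of the crux is the TWISTED DETAILED BALANCE
  `a b′ = a′ b` between the true incoming pair law `a` and the product `b = h h_*` of the `(r,ϑ)`-MOLLIFIED one-body law.
* `twoGaussian_mixture_strict`, `mixture_mollifier_breaks_twisted_balance`, `mixture_witness_geometry`,
  `not_twistedBalance_for_mixtures` — the r-ball MIXTURE obstruction: with a perfectly Maxwellian (chaotic, `J`-even) local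
  pair law but a two-temperature mollified `h` (ball straddling thermal structure finer than `r`), twisted balance FAILS on
  the explicit collision `n̂ = −e₀, v = e₀ + e₁, w = 0` (energies `(2,0) ↦ (1,1)`); so the `r₀`-free strengthening of the
  crux is false and the crux lives entirely off the `r → 0` passage AFTER `N → ∞` (lethal only for O(1)-volume sub-`r`
  structure of the limit fields, which the filed `∀ τ > 0` does not exclude — see the Disproof file §5 for the typed repair).
* `anisotropic_mollifier_breaks_twisted_balance` — the same failure at FIRST order in the anisotropy for an anisotropic
  Gaussian mollified law (leading effect of sub-`r` Reynolds stresses), collision `n = e₀+e₁, v = 2e₀, w = 0`.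
* `twisted_balance_of_logQuadratic` — tightness in `ϑ`: a log-collision-invariant discrepancy `f = h·exp(α+β|u|²+⟪γ,u⟫)`
  (e.g. a Maxwellian under pure velocity mollification) satisfies twisted balance identically.
* `J_involutive`, `J_preserves_approach`, `J_comm_exchange` — the inverse collision `J(n̂,v,w) = (−n̂,v′,w′)` is an
  involution, preserves the approach speed (incoming ↦ incoming, same flux factor) and commutes with particle exchange.
-/

noncomputable section

open scoped InnerProductSpace BigOperators

namespace Summit.AtomisticToContinuum.HydrodynamicLimit.Theorems

namespace OddContactSymmetryNegative

open Literature.Analysis.FluidPDE Literature.MathematicalPhysics.KineticTheory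

/-! ## What oddness buys: the parity lemma and the twisted-detailed-balance residual -/

/-- **Finite skeleton of ParitySplit.**  On a finite index set with an involution `J`, a weight `m` is orthogonal to EVERY
`J`-odd test function iff `m` is `J`-even.  (The crux tests the reweighted incoming contact measure against every J-odd
bounded continuous mark; its limit content is therefore "reweighted contact weight is J-even", neither more nor less.)
[folklore] -/
theorem odd_sum_vanishes_iff_even {Q : Type*} [Fintype Q] (J : Q → Q) (hJ : Function.Involutive J)
    (m : Q → ℝ) :
    (∀ Ψ : Q → ℝ, (∀ q, Ψ (J q) = -Ψ q) → ∑ q, Ψ q * m q = 0) ↔ ∀ q, m (J q) = m q := by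
  constructor
  · intro H q
    have h1 : ∑ q, (m q - m (J q)) * m q = 0 :=
      H (fun q => m q - m (J q)) (by intro q; simp only [hJ q]; ring)
    have h2 : ∑ q, (m q - m (J q)) * m (J q) = -∑ q, (m q - m (J q)) * m q := by
      rw [← Finset.sum_neg_distrib]
      refine Fintype.sum_equiv (hJ.toPerm J) _ _ (fun q => ?_)
      simp only [Function.Involutive.coe_toPerm, hJ q]
      ring
    have h3 : ∑ q, (m q - m (J q)) ^ 2 = 0 := by
      have : ∑ q, (m q - m (J q)) ^ 2 =
          ∑ q, (m q - m (J q)) * m q - ∑ q, (m q - m (J q)) * m (J q) := by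
        rw [← Finset.sum_sub_distrib]
        refine Finset.sum_congr rfl (fun q _ => ?_)
        ring
      rw [this, h2, h1]
      ring
    have h4 : (m q - m (J q)) ^ 2 = 0 :=
      (Finset.sum_eq_zero_iff_of_nonneg (fun q _ => sq_nonneg (m q - m (J q)))).1 h3 q (Finset.mem_univ q)
    have h5 : m q - m (J q) = 0 := pow_eq_zero_iff (two_ne_zero) |>.1 h4
    linarith
  · intro hm Ψ hΨ
    have : ∑ q, Ψ q * m q = -∑ q, Ψ q * m q := by
      rw [← Finset.sum_neg_distrib]
      refine Fintype.sum_equiv (hJ.toPerm J) _ _ (fun q => ?_)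
      simp only [Function.Involutive.coe_toPerm, hΨ q, hm q]
      ring
    linarith

/-- **The reweighted odd residual.**  Dictionary: `a` = incoming contact pair density at `q = (n̂,v,w)`, `a'` = at `J q`,
`b = h(v)h(w)`, `b' = h(v′)h(w′)` with `h` the `(r,ϑ)`-mollified one-body law read at the collision point, so that the crux's
weight `1 + e^{−F}` is `1 + b'/b` at `q` and `1 + b/b'` at `J q`.  The `J`-odd part of the reweighted weight is
`(a b' − a' b)(1/b + 1/b')`. [folklore] -/
theorem reweighted_odd_residual (a a' b b' : ℝ) (hb : b ≠ 0) (hb' : b' ≠ 0) :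
    a * (1 + b' / b) - a' * (1 + b / b') = (a * b' - a' * b) * (1 / b + 1 / b') := by
  field_simp
  ring

/-- **Twisted detailed balance is the exact limit content.**  With positive mollified weights, the reweighted weight is
`J`-even at `q` iff `a b' = a' b`, i.e. iff `a/(h h_*)` is `J`-invariant: the crux couples the TRUE incoming pair law to the
MOLLIFIED one-body law; it is not the bare statement `γ_a = 0` unless `h` is the true local law up to a log-collision-invariant
factor (§4). [folklore] -/
theorem reweighted_odd_residual_eq_zero_iff (a a' b b' : ℝ) (hb : 0 < b) (hb' : 0 < b') :
    a * (1 + b' / b) - a' * (1 + b / b') = 0 ↔ a * b' = a' * b := by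
  rw [reweighted_odd_residual a a' b b' hb.ne' hb'.ne', mul_eq_zero, sub_eq_zero]
  have hpos : 0 < 1 / b + 1 / b' := by positivity
  constructor
  · rintro (h | h)
    · exact h
    · exact absurd h hpos.ne'
  · exact fun h => Or.inl h

/-! ## The r-ball mixture obstruction (explicit two-temperature witness) -/

/-- **Two-Gaussian mixtures are strictly log-convex in the energy.**  For positive amplitudes and two DIFFERENT temperatures,
`h(E) = C₁ e^{−E/2θ₁} + C₂ e^{−E/2θ₂}` satisfies `h(c)² < h(2c)·h(0)` for `c ≠ 0`
(`h(2c)h(0) − h(c)² = C₁C₂ (e^{−c/2θ₁} − e^{−c/2θ₂})²`).  A single Maxwellian gives equality (energy conservation); the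
mixture does not. [folklore] -/
theorem twoGaussian_mixture_strict {C₁ C₂ θ₁ θ₂ c : ℝ} (hC₁ : 0 < C₁) (hC₂ : 0 < C₂)
    (h₁ : 0 < θ₁) (h₂ : 0 < θ₂) (hne : θ₁ ≠ θ₂) (hc : c ≠ 0) :
    (C₁ * Real.exp (-c / (2 * θ₁)) + C₂ * Real.exp (-c / (2 * θ₂))) *
        (C₁ * Real.exp (-c / (2 * θ₁)) + C₂ * Real.exp (-c / (2 * θ₂))) <
      (C₁ * Real.exp (-(2 * c) / (2 * θ₁)) + C₂ * Real.exp (-(2 * c) / (2 * θ₂))) *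
        (C₁ * Real.exp (-0 / (2 * θ₁)) + C₂ * Real.exp (-0 / (2 * θ₂))) := by
  set x := Real.exp (-c / (2 * θ₁)) with hxdef
  set y := Real.exp (-c / (2 * θ₂)) with hydef
  have hx : Real.exp (-(2 * c) / (2 * θ₁)) = x ^ 2 := by
    rw [hxdef, sq, ← Real.exp_add]; congr 1; ring
  have hy : Real.exp (-(2 * c) / (2 * θ₂)) = y ^ 2 := by
    rw [hydef, sq, ← Real.exp_add]; congr 1; ring
  have hxy : x ≠ y := by
    intro heq
    have h' : -c / (2 * θ₁) = -c / (2 * θ₂) := Real.exp_injective heq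
    rw [div_eq_div_iff (by positivity) (by positivity)] at h'
    have h'' : c * (θ₁ - θ₂) = 0 := by linarith
    rcases mul_eq_zero.1 h'' with h0 | h0
    · exact hc h0
    · exact hne (sub_eq_zero.1 h0)
  have h0 : Real.exp (-0 / (2 * θ₁)) = 1 := by rw [neg_zero, zero_div, Real.exp_zero]
  have h0' : Real.exp (-0 / (2 * θ₂)) = 1 := by rw [neg_zero, zero_div, Real.exp_zero]
  rw [hx, hy, h0, h0']
  have key : (C₁ * x ^ 2 + C₂ * y ^ 2) * (C₁ * 1 + C₂ * 1) - (C₁ * x + C₂ * y) * (C₁ * x + C₂ * y) =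
      C₁ * C₂ * (x - y) ^ 2 := by ring
  have hpos : 0 < C₁ * C₂ * (x - y) ^ 2 := by
    have := sq_pos_of_ne_zero (sub_ne_zero.2 hxy)
    positivity
  linarith

/-- Unfolding of the centred unit-density Maxwellian used by the crux's velocity mollifier
(`hm = ∫ bx · localMaxwellian 1 (ϑ²) v (·)`). [folklore] -/
theorem localMaxwellian_one_zero (θ : ℝ) (u : V3) :
    localMaxwellian 1 θ (0 : V3) u =
      (2 * Real.pi * θ) ^ (-(Module.finrank ℝ V3 : ℝ) / 2) * Real.exp (-‖u‖ ^ 2 / (2 * θ)) := by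
  simp only [localMaxwellian, sub_zero, one_mul]

/-- **The mixture mollifier breaks twisted balance on an explicit collision.**  Let the mollified law at the collision
point be the equal-weight two-temperature mixture `hmix = M_{θ₁} + M_{θ₂}` (a ball of radius `r` straddling a temperature
step, or any sub-`r` thermal structure), `θ₁ ≠ θ₂`.  On any collision with pre-energies `(2c, 0)` and post-energies `(c, c)`
one has `hmix(v′)hmix(w′) < hmix(v)hmix(w)`, i.e. `b' < b` in the dictionary of `reweighted_odd_residual`; if the TRUE local
pair law is chaotic-Maxwellian at ONE temperature (`a = a'`, perfect local equilibrium, `γ` J-even) the odd residual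
`a(b' − b)(1/b + 1/b') ≠ 0`: the reweighted odd statistic converges to a NON-ZERO value at that fixed `(r,ϑ)` although nothing
is out of local equilibrium.  Harmless iff the mixture volume → 0 as `r → 0` after `N → ∞`. [folklore] -/
theorem mixture_mollifier_breaks_twisted_balance {θ₁ θ₂ c : ℝ} (h₁ : 0 < θ₁) (h₂ : 0 < θ₂) (hne : θ₁ ≠ θ₂)
    (hc : c ≠ 0) (v w v' w' : V3)
    (hv : ‖v‖ ^ 2 = 2 * c) (hw : ‖w‖ ^ 2 = 0) (hv' : ‖v'‖ ^ 2 = c) (hw' : ‖w'‖ ^ 2 = c) :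
    (localMaxwellian 1 θ₁ (0 : V3) v' + localMaxwellian 1 θ₂ (0 : V3) v') *
        (localMaxwellian 1 θ₁ (0 : V3) w' + localMaxwellian 1 θ₂ (0 : V3) w') <
      (localMaxwellian 1 θ₁ (0 : V3) v + localMaxwellian 1 θ₂ (0 : V3) v) *
        (localMaxwellian 1 θ₁ (0 : V3) w + localMaxwellian 1 θ₂ (0 : V3) w) := by
  have hC₁ : 0 < (2 * Real.pi * θ₁) ^ (-(Module.finrank ℝ V3 : ℝ) / 2) :=
    Real.rpow_pos_of_pos (by positivity) _
  have hC₂ : 0 < (2 * Real.pi * θ₂) ^ (-(Module.finrank ℝ V3 : ℝ) / 2) :=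
    Real.rpow_pos_of_pos (by positivity) _
  have key := twoGaussian_mixture_strict hC₁ hC₂ h₁ h₂ hne hc
  simp only [localMaxwellian_one_zero, hv, hw, hv', hw']
  convert key using 2

/-- **Geometric realisation of the witness collision** (`c = 1`): impact direction `n̂ = −e₀` (unit, INCOMING for the pair
below: `⟪n̂, v − w⟫ = −1 < 0`), pre-velocities `v = e₀ + e₁`, `w = 0`; the crux's `reflectVel` gives post-velocities
`(e₁, e₀)`, so the energies go `(2, 0) ↦ (1, 1)` — exactly the hypotheses of `mixture_mollifier_breaks_twisted_balance`.
[folklore] -/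
theorem mixture_witness_geometry :
    let e₀ : V3 := EuclideanSpace.single (0 : Fin 3) (1 : ℝ)
    let e₁ : V3 := EuclideanSpace.single (1 : Fin 3) (1 : ℝ)
    ‖(-e₀ : V3)‖ = 1 ∧ ⟪(-e₀ : V3), (e₀ + e₁) - 0⟫_ℝ < 0 ∧
      reflectVel (-e₀) (e₀ + e₁, (0 : V3)) = (e₁, e₀) ∧
      ‖e₀ + e₁‖ ^ 2 = 2 * 1 ∧ ‖(0 : V3)‖ ^ 2 = 0 ∧ ‖e₁‖ ^ 2 = 1 ∧ ‖e₀‖ ^ 2 = 1 := by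
  intro e₀ e₁
  have n0 : ‖e₀‖ = 1 := by simp [e₀]
  have n1 : ‖e₁‖ = 1 := by simp [e₁]
  have i00 : ⟪e₀, e₀⟫_ℝ = 1 := by simp [e₀]
  have i11 : ⟪e₁, e₁⟫_ℝ = 1 := by simp [e₁]
  have i01 : ⟪e₀, e₁⟫_ℝ = 0 := by
    simp only [e₀, e₁, EuclideanSpace.inner_single_left, PiLp.single_apply]
    norm_num
  have i10 : ⟪e₁, e₀⟫_ℝ = 0 := by
    simp only [e₀, e₁, EuclideanSpace.inner_single_left, PiLp.single_apply]
    norm_num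
  have hsum : ‖e₀ + e₁‖ ^ 2 = 2 := by
    rw [← real_inner_self_eq_norm_sq, inner_add_left, inner_add_right, inner_add_right, i00, i01, i10, i11]
    norm_num
  refine ⟨by rw [norm_neg, n0], ?_, ?_, by rw [hsum]; norm_num, by simp, by rw [n1]; norm_num, by rw [n0]; norm_num⟩
  · rw [sub_zero, inner_neg_left, inner_add_right, i00, i01]
    norm_num
  · have hcoef : ⟪(e₀ + e₁) - 0, -e₀⟫_ℝ / ‖(-e₀ : V3)‖ ^ 2 = -1 := by
      rw [sub_zero, inner_neg_right, inner_add_left, i00, i10, norm_neg, n0]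
      norm_num
    simp only [reflectVel, hcoef, Prod.mk.injEq]
    constructor
    · simp only [neg_one_smul, neg_neg]
      abel
    · simp only [neg_one_smul, neg_neg, zero_add]


/-- **Refuted strengthening .**  "Twisted balance `h(v)h(w) = h(v′)h(w′)` holds on every collision for every
two-temperature mollified law" is false: `θ₁ = 1, θ₂ = 2`, `n = −e₀`, `v = e₀ + e₁`, `w = 0`.  Hence "the reweighted odd
statistic vanishes at FIXED `(r,ϑ)` for all data" — the `r₀`-free strengthening of the crux's limit content — fails
already against perfectly chaotic Maxwellian pair laws; only the `r → 0` passage can save the crux. [folklore] -/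
theorem not_twistedBalance_for_mixtures :
    ¬ (∀ θ₁ θ₂ : ℝ, 0 < θ₁ → 0 < θ₂ → ∀ n v w : V3,
        (localMaxwellian 1 θ₁ (0 : V3) v + localMaxwellian 1 θ₂ (0 : V3) v) *
            (localMaxwellian 1 θ₁ (0 : V3) w + localMaxwellian 1 θ₂ (0 : V3) w) =
          (localMaxwellian 1 θ₁ (0 : V3) (reflectVel n (v, w)).1 + localMaxwellian 1 θ₂ (0 : V3) (reflectVel n (v, w)).1) *
            (localMaxwellian 1 θ₁ (0 : V3) (reflectVel n (v, w)).2 +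
              localMaxwellian 1 θ₂ (0 : V3) (reflectVel n (v, w)).2)) := by
  intro H
  obtain ⟨_, _, hrefl, hv, hw, h1, h0⟩ := mixture_witness_geometry
  set e₀ : V3 := EuclideanSpace.single (0 : Fin 3) (1 : ℝ)
  set e₁ : V3 := EuclideanSpace.single (1 : Fin 3) (1 : ℝ)
  have heq := H 1 2 one_pos two_pos (-e₀) (e₀ + e₁) 0
  rw [hrefl] at heq
  have hlt := mixture_mollifier_breaks_twisted_balance (θ₁ := 1) (θ₂ := 2) one_pos two_pos (by norm_num)
    (c := 1) one_ne_zero (e₀ + e₁) 0 e₁ e₀ hv hw h1 h0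
  linarith


/-- **Anisotropic sub-`r` velocity structure breaks twisted balance at FIRST order (§3c).**  If the ball of radius
`r` carries velocity fluctuations with an ANISOTROPIC covariance (the leading effect of any sub-`r` shear/vortical
structure — Reynolds stresses of a turbulent or rolled-up layer — on the mollified law), `h_r` is to leading order an
anisotropic Gaussian `h(u) = exp(−u₀²/2θ₁ − (u₁²+u₂²)/2θ₂)`, `θ₁ ≠ θ₂`.  On the collision `n = e₀ + e₁` (unnormalised;
`reflectVel` normalises), `v = 2e₀`, `w = 0` (incoming for the reversed normal, approach speed `2`), the post-velocities are
`(e₀ − e₁, e₀ + e₁)`: x-energy `4 ↦ 2`, y-energy `0 ↦ 2`, so `h(v′)h(w′) ≠ h(v)h(w)` — twisted balance fails at first order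
in `1/θ₁ − 1/θ₂` — while the isotropic Maxwellian pair weight (last conjunct, the TRUE chaotic local pair law) is balanced.
With `reweighted_odd_residual` this is an O(anisotropy) NON-zero limit of the crux statistic at every fixed `r` above the
structure's scale: the algebra of the one live kill mechanism (O(1)-volume sub-`r` structure at some horizon `τ`). [folklore] -/
theorem anisotropic_mollifier_breaks_twisted_balance {θ₁ θ₂ : ℝ} (h₁ : 0 < θ₁) (h₂ : 0 < θ₂) (hne : θ₁ ≠ θ₂) :
    let e₀ : V3 := EuclideanSpace.single (0 : Fin 3) (1 : ℝ)
    let e₁ : V3 := EuclideanSpace.single (1 : Fin 3) (1 : ℝ)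
    let h : V3 → ℝ := fun u => Real.exp (-(u 0) ^ 2 / (2 * θ₁) - ((u 1) ^ 2 + (u 2) ^ 2) / (2 * θ₂))
    reflectVel (e₀ + e₁) ((2 : ℝ) • e₀, (0 : V3)) = (e₀ - e₁, e₀ + e₁) ∧
      ⟪e₀ + e₁, (2 : ℝ) • e₀ - 0⟫_ℝ = 2 ∧
      h (e₀ - e₁) * h (e₀ + e₁) ≠ h ((2 : ℝ) • e₀) * h 0 ∧
      Real.exp (-‖e₀ - e₁‖ ^ 2 / 2) * Real.exp (-‖e₀ + e₁‖ ^ 2 / 2) =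
        Real.exp (-‖(2 : ℝ) • e₀‖ ^ 2 / 2) * Real.exp (-‖(0 : V3)‖ ^ 2 / 2) := by
  intro e₀ e₁ h
  have i00 : ⟪e₀, e₀⟫_ℝ = 1 := by simp [e₀]
  have i11 : ⟪e₁, e₁⟫_ℝ = 1 := by simp [e₁]
  have i01 : ⟪e₀, e₁⟫_ℝ = 0 := by
    simp only [e₀, e₁, EuclideanSpace.inner_single_left, PiLp.single_apply]
    norm_num
  have i10 : ⟪e₁, e₀⟫_ℝ = 0 := by
    simp only [e₀, e₁, EuclideanSpace.inner_single_left, PiLp.single_apply]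
    norm_num
  have hsum : ‖e₀ + e₁‖ ^ 2 = 2 := by
    rw [← real_inner_self_eq_norm_sq, inner_add_left, inner_add_right, inner_add_right, i00, i01, i10, i11]
    norm_num
  have hdiff : ‖e₀ - e₁‖ ^ 2 = 2 := by
    rw [← real_inner_self_eq_norm_sq, inner_sub_left, inner_sub_right, inner_sub_right, i00, i01, i10, i11]
    norm_num
  have n0 : ‖e₀‖ = 1 := by simp [e₀]
  have htwo : ‖(2 : ℝ) • e₀‖ ^ 2 = 4 := by
    rw [norm_smul, Real.norm_eq_abs, n0]; norm_num
  have hin : ⟪(2 : ℝ) • e₀ - 0, e₀ + e₁⟫_ℝ = 2 := by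
    rw [sub_zero, inner_smul_left, inner_add_right, i00, i01]; norm_num
  refine ⟨?_, ?_, ?_, ?_⟩
  · have hcoef : ⟪(2 : ℝ) • e₀ - 0, e₀ + e₁⟫_ℝ / ‖e₀ + e₁‖ ^ 2 = 1 := by
      rw [hin, hsum]; norm_num
    simp only [reflectVel, hcoef, one_smul, zero_add, Prod.mk.injEq, and_true]
    rw [two_smul]
    abel
  · rw [← inner_conj_symm]
    simpa using hin
  · -- coordinates
    have c0 : ∀ j : Fin 3, e₀ j = if j = 0 then 1 else 0 := by intro j; simp [e₀, PiLp.single_apply]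
    have c1 : ∀ j : Fin 3, e₁ j = if j = 1 then 1 else 0 := by intro j; simp [e₁, PiLp.single_apply]
    have d20 : ((2 : Fin 3) = 0) = False := eq_false (by decide)
    have d21 : ((2 : Fin 3) = 1) = False := eq_false (by decide)
    have d10 : ((1 : Fin 3) = 0) = False := eq_false (by decide)
    have d01 : ((0 : Fin 3) = 1) = False := eq_false (by decide)
    have hA : h (e₀ - e₁) = Real.exp (-1 / (2 * θ₁) - 1 / (2 * θ₂)) := by
      simp only [h, PiLp.sub_apply, c0, c1, d20, d21, d10, d01, if_true, if_false]
      congr 1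
      ring
    have hB : h (e₀ + e₁) = Real.exp (-1 / (2 * θ₁) - 1 / (2 * θ₂)) := by
      simp only [h, PiLp.add_apply, c0, c1, d20, d21, d10, d01, if_true, if_false]
      congr 1
      ring
    have hC : h ((2 : ℝ) • e₀) = Real.exp (-4 / (2 * θ₁)) := by
      simp only [h, PiLp.smul_apply, c0, d20, d10, if_true, if_false, smul_eq_mul]
      congr 1
      ring
    have hD : h 0 = 1 := by
      simp [h]
    rw [hA, hB, hC, hD, mul_one, ← Real.exp_add]
    intro heq
    have := Real.exp_injective heq
    field_simp at this
    apply hne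
    nlinarith [this]
  · rw [hdiff, hsum, htwo, norm_zero, ← Real.exp_add, ← Real.exp_add]
    norm_num

/-! ## Tightness in `ϑ`: log-quadratic discrepancies are invisible -/

/-- **Twisted balance holds whenever true/mollified is log-quadratic.**  If `f = h · exp(α + β‖u‖² + ⟪γ,u⟫)` (a
log-collision-invariant factor) then for EVERY impact direction `n` and pre-velocities `(v,w)`, with `(v′,w′) = reflectVel n
(v,w)`: `f(v)f(w)·h(v′)h(w′) = f(v′)f(w′)·h(v)h(w)`, i.e. `a b' = a' b` for `a = f f_*` (chaotic pair law) and `b = h h_*`.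
Momentum and energy conservation of the tree's `reflectVel` are the only inputs.  Since Gaussian ⋆ Gaussian is Gaussian, a
local Maxwellian mollified in velocity only (`ϑ > 0`, `r → 0`) is related to itself by such a factor: the velocity scale `ϑ`
of the crux never produces a spurious odd signal at local equilibrium. [folklore] -/
theorem twisted_balance_of_logQuadratic (f h : V3 → ℝ) (α β : ℝ) (γ : V3)
    (hfh : ∀ u, f u = h u * Real.exp (α + β * ‖u‖ ^ 2 + ⟪γ, u⟫_ℝ)) (n v w : V3) :
    f v * f w * (h (reflectVel n (v, w)).1 * h (reflectVel n (v, w)).2) =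
      f (reflectVel n (v, w)).1 * f (reflectVel n (v, w)).2 * (h v * h w) := by
  have hE : ‖(reflectVel n (v, w)).1‖ ^ 2 + ‖(reflectVel n (v, w)).2‖ ^ 2 = ‖v‖ ^ 2 + ‖w‖ ^ 2 :=
    norm_sq_reflectVel_fst_add_norm_sq_reflectVel_snd n (v, w)
  have hP : (reflectVel n (v, w)).1 + (reflectVel n (v, w)).2 = v + w :=
    reflectVel_fst_add_reflectVel_snd n (v, w)
  have hI : ⟪γ, (reflectVel n (v, w)).1⟫_ℝ + ⟪γ, (reflectVel n (v, w)).2⟫_ℝ = ⟪γ, v⟫_ℝ + ⟪γ, w⟫_ℝ := by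
    rw [← inner_add_right, ← inner_add_right, hP]
  have hexp : Real.exp (α + β * ‖v‖ ^ 2 + ⟪γ, v⟫_ℝ) * Real.exp (α + β * ‖w‖ ^ 2 + ⟪γ, w⟫_ℝ) =
      Real.exp (α + β * ‖(reflectVel n (v, w)).1‖ ^ 2 + ⟪γ, (reflectVel n (v, w)).1⟫_ℝ) *
        Real.exp (α + β * ‖(reflectVel n (v, w)).2‖ ^ 2 + ⟪γ, (reflectVel n (v, w)).2⟫_ℝ) := by
    rw [← Real.exp_add, ← Real.exp_add]
    congr 1
    linear_combination (-β) * hE - hI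
  rw [hfh v, hfh w, hfh (reflectVel n (v, w)).1, hfh (reflectVel n (v, w)).2]
  linear_combination (h v * h w * h (reflectVel n (v, w)).1 * h (reflectVel n (v, w)).2) * hexp

/-! ## Kinematics of the inverse collision `J(n̂,v,w) = (−n̂, v′, w′)` -/

/-- `J` is an involution on the velocity components (and trivially on `n̂`): `reflectVel (−n) ∘ reflectVel n = id`.
[folklore] -/
theorem J_involutive (n : V3) (p : V3 × V3) : reflectVel (-n) (reflectVel n p) = p := by
  rw [reflectVel_neg, reflectVel_reflectVel]

/-- `J` preserves the approach speed: `⟪−n, v′ − w′⟫ = ⟪n, v − w⟫`.  So `J` maps incoming collision parameters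
(`⟪n̂, v − w⟫ < 0`) to incoming ones with the SAME flux factor `((w−v)·n̂)₊`; together with the measure-preserving
`(v,w) ↦ (v′,w′)` and `n̂ ↦ −n̂` this is why the chaotic collision measure `((w−v)·n̂)₊ f(v)f(w) dn̂ dv dw` pairs with
its `J`-image and the H-split is exact. [folklore] -/
theorem J_preserves_approach (n : V3) (p : V3 × V3) :
    ⟪-n, (reflectVel n p).1 - (reflectVel n p).2⟫_ℝ = ⟪n, p.1 - p.2⟫_ℝ := by
  by_cases hn : n = 0
  · subst hn
    simp
  · rw [inner_neg_left, inner_reflectVel_fst_sub_snd n hn p, neg_neg]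

/-- `J` commutes with particle exchange `S(n̂,v,w) = (−n̂,w,v)` on the velocity components:
`reflectVel (−n) (w,v) = ((reflectVel n (v,w)).2, (reflectVel n (v,w)).1)`.  The crux's ordered-pair double sum reads
`χ, g, h` at `x_i` for `(i,j)` and at `x_j` for `(j,i)` (distance `ε`), i.e. it symmetrises the mark over `S` up to
`O(ε/r)`; since `S` and `J` commute, the `S`-symmetrisation of a `J`-odd mark is `J`-odd — no parity is created or lost.
[folklore] -/
theorem J_comm_exchange (n : V3) (p : V3 × V3) :
    reflectVel (-n) (p.2, p.1) = ((reflectVel n p).2, (reflectVel n p).1) := by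
  rw [reflectVel_neg, reflectVel_swap]

end OddContactSymmetryNegative

end Summit.AtomisticToContinuum.HydrodynamicLimit.Theorems
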